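import Mathlib
import Summits.Ventures.HodgeRepro2.T5PrincipalUnitFiltration
import Summits.Ventures.HodgeRepro2.T5PrincipalUnitComparison
import Summits.Ventures.HodgeRepro2.T5ConductorExistence
import Summits.Ventures.HodgeRepro2.T5LocalFieldUnitsDecomposition

/-!
# (A10) inflated to the multiplicative group of the local field
(kernel witness assembling the standard fact (A10) of the Tier-5 [A]-ledger end to end:
«at an inert `v`, conjugate-orthogonal characters of `E_v^×` — trivial on `F_v^×` — of every exact
conductor `a ≥ 1` exist»)

* `exists_extension_trivial_on` — **inflation**: for `S` a discrete valuation ring with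
  uniformiser `ϖ`, `L = Frac S`, and a subgroup `F ≤ Lˣ` containing `ϖ`, every character of `Sˣ`
  trivial on `Sˣ ∩ F` extends to a character of `Lˣ` trivial on `F`
  (`Lˣ/F ≅ Sˣ/(Sˣ ∩ F)`, `T5LocalFieldUnitsDecomposition`);
* `exists_character_trivial_on_exact_level` — **(A10) as stated**: `R → S` an injective map of
  discrete valuation rings with a common uniformiser `ϖ`, `S` with finite residue field and
  residue map `R/(ϖ) → S/(ϖ)` not surjective, `F ≤ Lˣ` containing `ϖ` with `F ∩ Sˣ = image of Rˣ`
  (`F = F_v^×`, `F_v^× ∩ 𝒪_E^× = 𝒪_F^×`): for every `n` there is `χ' : Lˣ →* ℂˣ` trivial on `F`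
  and on `U_{S,n+1}`, non-trivial on `U_{S,n}` — a conjugate-orthogonal character of exact
  conductor `n + 1`.

Stays prose: the identification of `F` with `F_v^× ⊂ E_v^×` and the local-field facts behind the
hypotheses (common uniformiser at an inert place, residue degree `2`, finite residue field).
Imports: Mathlib + four accepted files of this prefix; axioms standard.
Uses an L-value-free non-vanishing device: NO (README §8(d)).
-/
namespace Summit.Ventures.HodgeRepro2.T5ConductorExistenceInflated

open Summit.Ventures.HodgeRepro2.T5PrincipalUnitFiltration
open Summit.Ventures.HodgeRepro2.T5PrincipalUnitComparison
open Summit.Ventures.HodgeRepro2.T5ConductorExistence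
open Summit.Ventures.HodgeRepro2.T5LocalFieldUnitsDecomposition

section Extension

variable {S L : Type*} [CommRing S] [Field L] [Algebra S L] [IsFractionRing S L] (ϖ : S)

/-- The map `Sˣ → Lˣ` is injective. -/
theorem unitsMapL_injective :
    Function.Injective (Units.map (algebraMap S L).toMonoidHom : Sˣ →* Lˣ) :=
  Units.map_injective (IsFractionRing.injective S L)

variable [IsDomain S] [IsDiscreteValuationRing S]

/-- **Inflation.** A character `χ` of `Sˣ` trivial on `Sˣ ∩ F` (for a subgroup `F ≤ Lˣ` containing
the uniformiser) extends to a character of `Lˣ` trivial on `F`: `Lˣ/F ≅ Sˣ/(Sˣ ∩ F)`. -/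
theorem exists_extension_trivial_on (hϖ : Irreducible ϖ) (F : Subgroup Lˣ)
    (hF : uniformizerUnit (L := L) ϖ hϖ ∈ F) (χ : Sˣ →* ℂˣ)
    (hχ : ∀ s : Sˣ, Units.map (algebraMap S L).toMonoidHom s ∈ F → χ s = 1) :
    ∃ χ' : Lˣ →* ℂˣ, (∀ f ∈ F, χ' f = 1) ∧
      ∀ s : Sˣ, χ' (Units.map (algebraMap S L).toMonoidHom s) = χ s := by
  set ι : Sˣ →* Lˣ := Units.map (algebraMap S L).toMonoidHom with hι
  have hinj : Function.Injective ι := unitsMapL_injective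
  let e : Sˣ ≃* ι.range := MonoidHom.ofInjective hinj
  let χr : ι.range →* ℂˣ := χ.comp e.symm.toMonoidHom
  have hker : F.subgroupOf ι.range ≤ χr.ker := by
    intro x hx
    rw [MonoidHom.mem_ker]
    show χ (e.symm x) = 1
    apply hχ
    rw [Subgroup.mem_subgroupOf] at hx
    have h1 : ι (e.symm x) = (x : Lˣ) := MonoidHom.apply_ofInjective_symm hinj x
    rw [h1]
    exact hx
  let χq : ι.range ⧸ F.subgroupOf ι.range →* ℂˣ := QuotientGroup.lift _ χr hker
  let iso : ι.range ⧸ F.subgroupOf ι.range ≃* Lˣ ⧸ F := quotientEquivOfUniformizerMem ϖ hϖ F hF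
  let χ' : Lˣ →* ℂˣ := (χq.comp iso.symm.toMonoidHom).comp (QuotientGroup.mk' F)
  refine ⟨χ', fun f hf => ?_, fun s => ?_⟩
  · show χq (iso.symm ((QuotientGroup.mk' F) f)) = 1
    have h0 : (QuotientGroup.mk' F) f = 1 := (QuotientGroup.eq_one_iff f).mpr hf
    rw [h0, map_one, map_one]
  · show χq (iso.symm ((QuotientGroup.mk' F) (ι s))) = χ s
    have hsym : iso.symm ((QuotientGroup.mk' F) (ι s)) = QuotientGroup.mk (e s) := by
      rw [MulEquiv.symm_apply_eq]
      rfl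
    rw [hsym]
    show χ (e.symm (e s)) = χ s
    rw [MulEquiv.symm_apply_apply]

end Extension

section Assembly

variable {R S L : Type*} [CommRing R] [CommRing S] [Algebra R S] [IsDomain R] [IsDomain S]
  [IsDiscreteValuationRing R] [IsDiscreteValuationRing S] [Field L] [Algebra S L]
  [IsFractionRing S L] (ϖ : R)

/-- **(A10) inflated to `E_v^×`.** Let `R → S` be an injective map of discrete valuation rings
with a common uniformiser `ϖ`, `S` with finite residue field and residue map `R/(ϖ) → S/(ϖ)` not
surjective (an inert place); let `L = Frac S` and `F ≤ Lˣ` a subgroup containing `ϖ` whose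
intersection with `Sˣ` is exactly the image of `Rˣ` (`F = F_v^×`, `F ∩ 𝒪_E^× = 𝒪_F^×`).  Then for
every `n` there is a character `χ' : Lˣ →* ℂˣ` trivial on `F`, trivial on `U_{S,n+1}` and
non-trivial on `U_{S,n}`: a «conjugate-orthogonal» character of exact conductor `n + 1`. -/
theorem exists_character_trivial_on_exact_level (hinj : Function.Injective (algebraMap R S))
    (hϖ : Irreducible ϖ) (hϖS : Irreducible (algebraMap R S ϖ))
    [Finite (IsLocalRing.ResidueField S)]
    (hne : ¬ Function.Surjective (residueMap (S := S) ϖ)) (F : Subgroup Lˣ)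
    (hF : uniformizerUnit (L := L) (algebraMap R S ϖ) hϖS ∈ F)
    (hFS : ∀ s : Sˣ, Units.map (algebraMap S L).toMonoidHom s ∈ F →
      ∃ r : Rˣ, s = unitsMap (R := R) (S := S) r) (n : ℕ) :
    ∃ χ' : Lˣ →* ℂˣ, (∀ f ∈ F, χ' f = 1) ∧
      (∀ u ∈ higherUnits (algebraMap R S ϖ) (n + 1),
        χ' (Units.map (algebraMap S L).toMonoidHom u) = 1) ∧
      ∃ u ∈ higherUnits (algebraMap R S ϖ) n,
        χ' (Units.map (algebraMap S L).toMonoidHom u) ≠ 1 := by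
  obtain ⟨χ, hχ1, hχR, u, hu, hχu⟩ :=
    exists_character_exact_level ϖ hinj hϖ hϖS hne n
  have hχF : ∀ s : Sˣ, Units.map (algebraMap S L).toMonoidHom s ∈ F → χ s = 1 := by
    intro s hs
    obtain ⟨r, rfl⟩ := hFS s hs
    exact hχR r
  obtain ⟨χ', hχ'F, hχ'S⟩ := exists_extension_trivial_on (algebraMap R S ϖ) hϖS F hF χ hχF
  refine ⟨χ', hχ'F, fun v hv => ?_, u, hu, ?_⟩
  · rw [hχ'S]
    exact hχ1 v hv
  · rw [hχ'S]
    exact hχu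

end Assembly

end Summit.Ventures.HodgeRepro2.T5ConductorExistenceInflated
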